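/-
Copyright (c) 2026. All rights reserved.
Released under Apache 2.0 license as described in the file LICENSE.
Authors: abc-iut cell, prover seat abc-iut-w5-d097 (wave 5), over the statements of abc-iut-L4-t3 and the
generic core-incompatibility argument of abc-iut-L4-t10.
-/
import Literature.AnabelianGeometry.AbsoluteAnabelian.LogFrobeniusCoresProofs
import Literature.AnabelianGeometry.AbsoluteAnabelian.AbsTopIII.AutHolLogFrobeniusIncompatibility
import HarnessLib

/-!
# [AbsTopIII] Corollary 5.5 (iv), first sentence (`⊞`-half): REDUCTION to a component-level cycle obstruction

S. Mochizuki, *Topics in absolute anabelian geometry III: global reconstruction algorithms*,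
J. Math. Sci. Univ. Tokyo 22 (2015) 939–1156 [MochizukiAbsTopIII2015]; locators = pages of the author's manuscript
(`paper:url-5493eb38cbb7`): Cor 5.5 (iv) p. 131 ("The diagram of categories `D•_{≤2}` does not admit a structure of
core on `D•_{≤1}` which [i.e., whose constituent family of homotopies] is compatible with [the constituent family
of homotopies of] the observables `S_log`, `S_log⊞` of (iii)"), its proof pp. 132–133 ("amount, in an entirely
similar fashion, to the incompatibility of the introduction of a single model `(Γ⃗^log_v)_□` of `Γ⃗^log_v` that maps
isomorphically … to each copy `(Γ⃗^log_v)_⋎` … entirely similar to the proofs of assertion (iv) of Corollaries 3.6,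
4.5"), and the proof of Cor 4.5 (iv) p. 110 / Cor 3.6 (iv) p. 81 ("`ζ'₁ = ζ₂ ∘ ζ₁ ∘ ζ'₀` … must coincide with … by
writing out explicitly the meaning of such an equality … a contradiction to Lemma 4.4 [resp. 3.4]").

Proof-only companion (no new notion, no named `Prop`) of abc-iut-L4-t3's `LogFrobeniusCorollaries.lean`, which
types the FIRST sentence of Cor 5.5 (iv) against the `⊞`-observable `S_log⊞` only, as the named fact
`LogFrobeniusSetting.Cor55Incompatibility L` (FACT-LIST F-0141; the print-faithful form with both observables is
`Cor55LogWall`, F-3082, `LogFrobeniusObservables.lean`).  Here that typed statement is DERIVED from ONE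
component-level input, exactly as abc-iut-L4-t10 derived Cor 3.6 (iv) / Cor 4.5 (iv) from the Lemma 3.4 / Lemma 4.4
properties (`AbsTopIII.false_of_core_compatible_of_obstruction`, which this file APPLIES, unchanged, to the
realised diagram `D•⊢`):

* `LogFrobeniusSetting.cor55Incompatibility_of_cycleObstruction` — if at SOME place `v₀ ∈ V(F_mod)` the graph of
  `ι⊞`-carrying edges contains a 3-edge cycle through the post-log identification,
  `postLog →(ε₁) ν₂ →(ε₂) νₘ →(ε₃) spaceLink` (`ν₂`, `νₘ` pre-log), and for some object `x₀` of `𝒳` NO isomorphism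
  `a : x₀ ⥲ log(x₀)` makes the composite `λ⊞_{sl}(a) ≫ ι⊞_{ε₁} ≫ ι⊞_{ε₂} ≫ ι⊞_{ε₃}` (an endomorphism of
  `λ⊞_{v₀,sl}(x₀)`) the identity, then `L.Cor55Incompatibility`.  At an ARCHIMEDEAN `v₀` the cycle is the printed
  `k~ →(id) k~ ↠ k^× ↪ k` of Def 5.4 (v) p. 127 (all three arrows carry `ι⊞`, Def 5.4 (vii) p. 128: "respectively,
  `Γ⃗^log_v`" for archimedean `v`), and the obstruction reads "`k ⥲ k~ ↠(exp) k^× ↪ k` is not the identity" — the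
  Lemma 4.4 / Cor 4.5 (iv) mechanism.  (At a NONARCHIMEDEAN `v` the arrow `k̄^× ↪ k̄` is NOT in `Γ⃗^⋉_v`, so the
  `⊞`-observable offers no such cycle there; the nonarchimedean Lemma-3.4 content of print's (iv) is carried by the
  `TS`-valued `S_log`, i.e. by `Cor55LogWall`.)

The proof is the printed one: a common family `K` would contain the core homotopy `ζ₀` for
`([id_{⋎+1}], [id_⋎]∘[log])` (an isomorphism), the post-log homotopy `ι⊞_{ε₁}` for
`([λ⊞_{sl}]∘[id_⋎]∘[log], [λ⊞_{ν₂}]∘[id_{⋎+1}])` and (composing two pre-log homotopies) `ι⊞_{ε₂} ≫ ι⊞_{ε₃}` for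
`([λ⊞_{ν₂}], [λ⊞_{sl}])`; whiskering and composing gives a homotopy for the pair `([λ⊞_{sl}]∘[id_{⋎+1}],
[λ⊞_{sl}]∘[id_{⋎+1}])`, which must be the identity (Def 3.5 (ii)) — "writing out explicitly the meaning" at `x₀`
contradicts the obstruction.  Refereed pre-IUT material; OUR kernel check of a typed statement; nothing here
bears on [IUTchIII] Cor. 3.12; no side taken.
-/

set_option autoImplicit false

universe u

open CategoryTheory Quiver

namespace Literature.AnabelianGeometry.AbsoluteAnabelian

namespace LogFrobeniusSetting

variable {Vmod : Type u} {isArc : Vmod → Bool} (L : LogFrobeniusSetting Vmod isArc)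

/-- `𝒳_n ∈ D•_{≤1}`. [cite: MochizukiAbsTopIII2015, Cor 5.5 p. 130] -/
theorem row1_mem_one (n : ℤ) : (DVertex.row1 n : DVertex Vmod isArc).InFirstRows 1 := ⟨trivial, le_rfl⟩

/-- The post-log vertex is post-log. [cite: MochizukiAbsTopIII2015, Def 5.4 (iii) p. 126] -/
theorem postLog_isPostLog (b : Bool) : (LogVertex.postLog b).isPostLog = true := by
  cases b <;> rfl

/-- Transport of `IsIso` along a heterogeneous equality of natural transformations whose (co)domain functors are
propositionally equal (the path functors of Def 3.5 (i) are defined by recursion, so the homotopies of two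
families on embedded diagrams are compared by `HEq`, cf. `LogFrobeniusSetting.CompatibleIn`). [folklore] -/
private theorem isIso_of_heq_natTrans {C : Type (u + 1)} [Category.{u} C] {D : Type (u + 1)} [Category.{u} D]
    {F G F' G' : C ⥤ D} {α : F ⟶ G} {β : F' ⟶ G'} (h : HEq α β) (hF : F = F') (hG : G = G')
    (hα : IsIso α) : IsIso β := by
  subst hF hG
  cases h
  exact hα

/-- Components of a natural transformation heterogeneously equal to a given one. [folklore] -/
private theorem app_eq_of_heq_natTrans {C : Type (u + 1)} [Category.{u} C] {D : Type (u + 1)} [Category.{u} D]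
    {F G F' G' : C ⥤ D} {α : F ⟶ G} {β : F' ⟶ G'} (h : HEq α β) (hF : F = F') (hG : G = G') (x : C) :
    β.app x = eqToHom (Functor.congr_obj hF x).symm ≫ α.app x ≫ eqToHom (Functor.congr_obj hG x) := by
  subst hF hG
  cases h
  simp

/-- Composites of heterogeneously equal morphisms are heterogeneously equal. [folklore] -/
private theorem comp_heq_comp {C : Type (u + 1)} [Category.{u} C] {a b c a' b' c' : C} (ha : a = a')
    (hb : b = b') (hc : c = c') {f : a ⟶ b} {g : b ⟶ c} {f' : a' ⟶ b'} {g' : b' ⟶ c'} (hf : HEq f f')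
    (hg : HEq g g') : HEq (f ≫ g) (f' ≫ g') := by
  subst ha hb hc
  cases hf
  cases hg
  rfl

/-- **[AbsTopIII] Cor 5.5 (iv), first sentence, `⊞`-half, REDUCED to a component-level cycle obstruction at one
place.**  Data: a place `v₀`; pre-log vertices `ν₂`, `νₘ` of `Γ⃗^log_{v₀}`; `ι⊞`-carrying edges
`ε₁ : postLog → ν₂`, `ε₂ : ν₂ → νₘ`, `ε₃ : νₘ → spaceLink` (at an archimedean `v₀`: `postLogId`, `shell`,
`multToSpaceLink`); an object `x₀` of `𝒳`.  Hypothesis (the Lemma-4.4-type content, stated at the level of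
components; the three `m_i` are the components of `ι⊞_{v₀,ε_i}` at `x₀`, compared by `HEq` because the functor
`Λ_{ν}` in their domain, `frobeniusTwist`, and the identification `λ⊞_{spaceLink} = λ⊞_{postLog}` are only
propositionally the evident ones): for NO isomorphism `a : x₀ ⥲ log(x₀)` of `𝒳` is
`λ⊞_{v₀,sl}(a) ≫ m₁ ≫ m₂ ≫ m₃` the identity of `λ⊞_{v₀,sl}(x₀)`.  Conclusion: `L.Cor55Incompatibility`
("`D•_{≤2}` does not admit a structure of core on `D•_{≤1}` compatible with the observables `S_log⊞`").
[cite: MochizukiAbsTopIII2015, Cor 5.5 (iv) p. 131] -/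
theorem cor55Incompatibility_of_cycleObstruction (v₀ : Vmod) (ν₂ νₘ : LogVertex (isArc v₀))
    (h₂ : ν₂.isPostLog = false) (hₘ : νₘ.isPostLog = false)
    (ε₁ : LogEdge (isArc v₀) (LogVertex.postLog (isArc v₀)) ν₂) (ε₂ : LogEdge (isArc v₀) ν₂ νₘ)
    (ε₃ : LogEdge (isArc v₀) νₘ (LogVertex.spaceLink (isArc v₀))) (x₀ : L.X)
    (obstruction : ∀ (a : x₀ ⟶ L.log.obj x₀), IsIso a →
      ∀ (m₁ : (L.lam v₀ (LogVertex.spaceLink (isArc v₀))).obj (L.log.obj x₀) ⟶ (L.lam v₀ ν₂).obj x₀)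
        (m₂ : (L.lam v₀ ν₂).obj x₀ ⟶ (L.lam v₀ νₘ).obj x₀)
        (m₃ : (L.lam v₀ νₘ).obj x₀ ⟶ (L.lam v₀ (LogVertex.spaceLink (isArc v₀))).obj x₀),
        HEq m₁ ((L.iota v₀ ε₁).app x₀) → HEq m₂ ((L.iota v₀ ε₂).app x₀) → HEq m₃ ((L.iota v₀ ε₃).app x₀) →
          (L.lam v₀ (LogVertex.spaceLink (isArc v₀))).map a ≫ m₁ ≫ m₂ ≫ m₃ ≠ 𝟙 _) :
    L.Cor55Incompatibility := by
  rintro ⟨Hc, hHc, K, Hobs, hcore, hcK, hobsAll⟩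
  obtain ⟨⟨_, hpre, hpost⟩, hobsK⟩ := hobsAll v₀
  have hsl : (LogVertex.spaceLink (isArc v₀)).isPostLog = false := spaceLink_isPostLog _
  have hpl : (LogVertex.postLog (isArc v₀)).isPostLog = true := postLog_isPostLog _
  /- (1) the core homotopy `ζ₀` for `([id_{⋎+1}], [id_⋎]∘[log])` (`⋎ = 0`), transported into `K` -/
  -- the shape `D•_{≤1} ∪ {□}`, its vertices `𝒳_1`, `𝒳_0` and the three arrows used
  let X₁ : ExtShape.{u} (DSub (DVertex.InFirstRows (Vmod := Vmod) (isArc := isArc) 1)) :=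
    obsShape (DVertex.InFirstRows 1) DVertex.core
  let a₁ : X₁.Vertex := X₁.base ⟨.row1 (0 + 1), row1_mem_one (0 + 1)⟩
  let a₀ : X₁.Vertex := X₁.base ⟨.row1 0, row1_mem_one 0⟩
  let tc1 : a₁ ⟶ X₁.obs := DEdge.toCore (0 + 1)
  let lg : a₁ ⟶ a₀ := DEdge.log 0
  let tc0 : a₀ ⟶ X₁.obs := DEdge.toCore 0
  have hc₀ : Hc.E ((Path.nil : Path a₁ a₁).cons tc1) (((Path.nil : Path a₁ a₁).cons lg).cons tc0) :=
    hcore.boundary_all _ _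
  have hiso₀ : IsIso (Hc.η hc₀) :=
    DiagramOfCategories.HomotopyFamily.isIso_of_isSymmetric _ Hc hcore.isSymmetric hc₀
  obtain ⟨k₀, hk₀⟩ := hcK _ _ hc₀
  have k₀' : K.E ((Path.nil : Path (DVertex.row1 (0 + 1) : DVertex Vmod isArc) (DVertex.row1 (0 + 1))).cons
        (DEdge.toCore (0 + 1)))
      (((Path.nil : Path (DVertex.row1 (0 + 1) : DVertex Vmod isArc) (DVertex.row1 (0 + 1))).cons (DEdge.log 0)).cons
        (DEdge.toCore 0)) := k₀
  have hisoK : IsIso (K.η k₀') := by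
    refine isIso_of_heq_natTrans hk₀ ?_ ?_ hiso₀
    · simp only [DiagramOfCategories.pathFunctor_cons, DiagramOfCategories.pathFunctor_nil]; rfl
    · simp only [DiagramOfCategories.pathFunctor_cons, DiagramOfCategories.pathFunctor_nil]; rfl
  /- (2) the three pinned homotopies of `S_log⊞` at `v₀`, transported into `K` -/
  obtain ⟨hm₁, hpin₁⟩ := hpost (LogVertex.postLog (isArc v₀)) ν₂ ε₁ hpl h₂ hsl 0
  obtain ⟨hm₂, hpin₂⟩ := hpre ν₂ νₘ ε₂ h₂ hₘ
  obtain ⟨hm₃, hpin₃⟩ := hpre νₘ (LogVertex.spaceLink (isArc v₀)) ε₃ hₘ hsl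
  obtain ⟨k₁, hk₁⟩ := hobsK _ _ hm₁
  obtain ⟨k₂, hk₂⟩ := hobsK _ _ hm₂
  obtain ⟨k₃, hk₃⟩ := hobsK _ _ hm₃
  have k₁' : K.E
      ((((Path.nil : Path (DVertex.row1 (0 + 1) : DVertex Vmod isArc) (DVertex.row1 (0 + 1))).cons
        (DEdge.log 0)).cons (DEdge.toCore 0)).cons (DEdge.lam v₀ (LogVertex.spaceLink (isArc v₀)) hsl))
      (((Path.nil : Path (DVertex.row1 (0 + 1) : DVertex Vmod isArc) (DVertex.row1 (0 + 1))).cons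
        (DEdge.toCore (0 + 1))).cons (DEdge.lam v₀ ν₂ h₂)) := k₁
  have k₂' : K.E ((Path.nil : Path (DVertex.core : DVertex Vmod isArc) DVertex.core).cons (DEdge.lam v₀ ν₂ h₂))
      ((Path.nil : Path (DVertex.core : DVertex Vmod isArc) DVertex.core).cons (DEdge.lam v₀ νₘ hₘ)) := k₂
  have k₃' : K.E ((Path.nil : Path (DVertex.core : DVertex Vmod isArc) DVertex.core).cons (DEdge.lam v₀ νₘ hₘ))
      ((Path.nil : Path (DVertex.core : DVertex Vmod isArc) DVertex.core).cons
        (DEdge.lam v₀ (LogVertex.spaceLink (isArc v₀)) hsl)) := k₃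
  -- functor identifications along the explicit paths (the path functors are recursive: propositional only)
  have P₁d : (L.logDiagramPlus v₀).pathFunctor (postLogDomPath v₀ 0 hsl) =
      L.diagram.pathFunctor ((((Path.nil : Path (DVertex.row1 (0 + 1) : DVertex Vmod isArc)
        (DVertex.row1 (0 + 1))).cons (DEdge.log 0)).cons (DEdge.toCore 0)).cons
        (DEdge.lam v₀ (LogVertex.spaceLink (isArc v₀)) hsl)) := by
    simp only [postLogDomPath, logEdge, toCoreEdge, lamEdge, DiagramOfCategories.pathFunctor_cons,
      DiagramOfCategories.pathFunctor_nil]; rfl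
  have P₁c : (L.logDiagramPlus v₀).pathFunctor (postLogCodPath v₀ 0 ν₂ h₂) =
      L.diagram.pathFunctor (((Path.nil : Path (DVertex.row1 (0 + 1) : DVertex Vmod isArc)
        (DVertex.row1 (0 + 1))).cons (DEdge.toCore (0 + 1))).cons (DEdge.lam v₀ ν₂ h₂)) := by
    simp only [postLogCodPath, toCoreEdge, lamEdge, DiagramOfCategories.pathFunctor_cons,
      DiagramOfCategories.pathFunctor_nil]; rfl
  have P₂ : ∀ (ν : LogVertex (isArc v₀)) (hν : ν.isPostLog = false),
      (L.logDiagramPlus v₀).pathFunctor (lamPath v₀ ν hν) =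
        L.diagram.pathFunctor ((Path.nil : Path (DVertex.core : DVertex Vmod isArc) DVertex.core).cons
          (DEdge.lam v₀ ν hν)) := by
    intro ν hν
    simp only [lamPath, lamEdge, DiagramOfCategories.pathFunctor_cons, DiagramOfCategories.pathFunctor_nil]; rfl
  have hk₁' : HEq ((Hobs v₀).η hm₁) (K.η k₁') := hk₁
  have hk₂' : HEq ((Hobs v₀).η hm₂) (K.η k₂') := hk₂
  have hk₃' : HEq ((Hobs v₀).η hm₃) (K.η k₃') := hk₃
  have K₁ := app_eq_of_heq_natTrans hk₁' P₁d P₁c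
  have K₂ := app_eq_of_heq_natTrans hk₂' (P₂ ν₂ h₂) (P₂ νₘ hₘ)
  have K₃ := app_eq_of_heq_natTrans hk₃' (P₂ νₘ hₘ) (P₂ _ hsl)
  /- (3) the functor identifications `Λ_ν = 𝟭` (pre-log `ν`), `Λ_{postLog} = log`, `λ⊞_{sl} = λ⊞_{postLog}`, as
  `eqToHom`-adapters turning the `ι⊞` into natural transformations between the EDGE functors of `D•⊢` -/
  have F1 : (L.log ⋙ 𝟭 L.X) ⋙ L.lam v₀ (LogVertex.spaceLink (isArc v₀)) =
      frobeniusTwist L.log (LogVertex.postLog (isArc v₀)).isPostLog ⋙ L.lam v₀ (LogVertex.postLog (isArc v₀)) := by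
    rw [hpl, L.lam_spaceLink_eq_postLog v₀]; rfl
  have F2 : L.lam v₀ ν₂ = frobeniusTwist L.log ν₂.isPostLog ⋙ L.lam v₀ ν₂ := by rw [h₂]; rfl
  have F3 : L.lam v₀ νₘ = frobeniusTwist L.log νₘ.isPostLog ⋙ L.lam v₀ νₘ := by rw [hₘ]; rfl
  obtain ⟨ιl, hιl⟩ : ∃ ιl : (L.log ⋙ 𝟭 L.X) ⋙ L.lam v₀ (LogVertex.spaceLink (isArc v₀)) ⟶ 𝟭 L.X ⋙ L.lam v₀ ν₂,
      ιl = eqToHom F1 ≫ L.iota v₀ ε₁ := ⟨_, rfl⟩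
  obtain ⟨ι₂, hι₂⟩ : ∃ ι₂ : L.lam v₀ ν₂ ⟶ L.lam v₀ νₘ, ι₂ = eqToHom F2 ≫ L.iota v₀ ε₂ := ⟨_, rfl⟩
  obtain ⟨ι₃, hι₃⟩ : ∃ ι₃ : L.lam v₀ νₘ ⟶ L.lam v₀ (LogVertex.spaceLink (isArc v₀)),
      ι₃ = eqToHom F3 ≫ L.iota v₀ ε₃ := ⟨_, rfl⟩
  have hιl_app : ∀ x : L.X, ιl.app x = eqToHom (Functor.congr_obj F1 x) ≫ (L.iota v₀ ε₁).app x := by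
    intro x; rw [hιl, NatTrans.comp_app, eqToHom_app]
  have hι₂_app : ∀ x : L.X, ι₂.app x = eqToHom (Functor.congr_obj F2 x) ≫ (L.iota v₀ ε₂).app x := by
    intro x; rw [hι₂, NatTrans.comp_app, eqToHom_app]
  have hι₃_app : ∀ x : L.X, ι₃.app x = eqToHom (Functor.congr_obj F3 x) ≫ (L.iota v₀ ε₃).app x := by
    intro x; rw [hι₃, NatTrans.comp_app, eqToHom_app]
  /- (4) the printed argument (`AbsTopIII.false_of_core_compatible_of_obstruction`, Cor 4.5 (iv) p. 110) on `D•⊢` -/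
  refine AbsTopIII.false_of_core_compatible_of_obstruction (D := L.diagram) K
    (DEdge.log 0) (DEdge.toCore (0 + 1)) (DEdge.toCore 0)
    (DEdge.lam v₀ (LogVertex.spaceLink (isArc v₀)) hsl) (DEdge.lam v₀ ν₂ h₂)
    (ι₂ ≫ ι₃) ιl k₀' hisoK (K.isSaturated.trans k₂' k₃') ?_ k₁' ?_ x₀ ?_
  · -- components of `ι⊞_{ε₂} ≫ ι⊞_{ε₃}` on the pair `([λ⊞_{ν₂}], [λ⊞_{sl}])`
    intro x e₁ e₂
    obtain ⟨o₂, o₂', H2⟩ := hpin₂ x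
    obtain ⟨o₃, o₃', H3⟩ := hpin₃ x
    refine (conj_eqToHom_iff_heq' _ _ e₁ e₂.symm).mpr ?_
    rw [K.η_trans k₂' k₃', NatTrans.comp_app, NatTrans.comp_app]
    have Q : ∀ (ν : LogVertex (isArc v₀)) (hν : ν.isPostLog = false),
        L.diagram.pathFunctor ((Path.nil : Path (DVertex.core : DVertex Vmod isArc) DVertex.core).cons
          (DEdge.lam v₀ ν hν)) = L.lam v₀ ν := by
      intro ν hν
      simp only [DiagramOfCategories.pathFunctor_cons, DiagramOfCategories.pathFunctor_nil]; rfl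
    have g₂ : HEq ((K.η k₂').app x) (ι₂.app x) :=
      (((conj_eqToHom_iff_heq' _ _ _ _).mp (K₂ x)).trans ((conj_eqToHom_iff_heq' _ _ o₂ o₂').mp H2)).trans
        (by rw [hι₂_app]; exact ((eqToHom_comp_heq_iff _ _ _).mpr HEq.rfl).symm)
    have g₃ : HEq ((K.η k₃').app x) (ι₃.app x) :=
      (((conj_eqToHom_iff_heq' _ _ _ _).mp (K₃ x)).trans ((conj_eqToHom_iff_heq' _ _ o₃ o₃').mp H3)).trans
        (by rw [hι₃_app]; exact ((eqToHom_comp_heq_iff _ _ _).mpr HEq.rfl).symm)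
    exact comp_heq_comp (Functor.congr_obj (Q ν₂ h₂) x) (Functor.congr_obj (Q νₘ hₘ) x)
      (Functor.congr_obj (Q _ hsl) x) g₂ g₃
  · -- components of `ι⊞_{ε₁}` on the pair `([λ⊞_{sl}]∘[id_0]∘[log], [λ⊞_{ν₂}]∘[id_1])`
    intro x e₁ e₂
    obtain ⟨o₁, o₁', H1⟩ := hpin₁ x
    refine (conj_eqToHom_iff_heq' _ _ e₁ e₂.symm).mpr ?_
    exact (((conj_eqToHom_iff_heq' _ _ _ _).mp (K₁ x)).trans ((conj_eqToHom_iff_heq' _ _ o₁ o₁').mp H1)).trans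
      (by rw [hιl_app]; exact ((eqToHom_comp_heq_iff _ _ _).mpr HEq.rfl).symm)
  · -- the obstruction: "writing out explicitly the meaning of `ζ'₁ = id`" at `x₀`
    intro a ha hid
    refine obstruction a ha (ιl.app x₀) (ι₂.app x₀) (ι₃.app x₀) ?_ ?_ ?_ ?_
    · rw [hιl_app]; exact (eqToHom_comp_heq_iff _ _ _).mpr HEq.rfl
    · rw [hι₂_app]; exact (eqToHom_comp_heq_iff _ _ _).mpr HEq.rfl
    · rw [hι₃_app]; exact (eqToHom_comp_heq_iff _ _ _).mpr HEq.rfl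
    · exact hid

/-- At an ARCHIMEDEAN place the `ι⊞`-carrying graph `Γ⃗^log_arc` (`k~ →(id) k~ ↠ k^× ↪ k`, Def 5.4 (v); every
arrow carries an `ι⊞`, Def 5.4 (vii)) contains the 3-edge cycle through the post-log identification required by
`cor55Incompatibility_of_cycleObstruction`: `ν₂ = k~` (pre-log copy), `νₘ = k^×`, edges `postLogId`, `shell`,
`multToSpaceLink`.  Stated for a Boolean `b = true` so that it applies to `b := isArc v₀` without transport.
[cite: MochizukiAbsTopIII2015, Def 5.4 (v) p. 127] -/
theorem exists_logCycle_of_eq_true (b : Bool) (hb : b = true) :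
    ∃ (ν₂ νₘ : LogVertex b) (_ : ν₂.isPostLog = false) (_ : νₘ.isPostLog = false),
      Nonempty (LogEdge b (LogVertex.postLog b) ν₂) ∧ Nonempty (LogEdge b ν₂ νₘ) ∧
        Nonempty (LogEdge b νₘ (LogVertex.spaceLink b)) := by
  subst hb
  exact ⟨ArchVertex.pre, ArchVertex.mult, rfl, rfl, ⟨ArchEdge.postLogId⟩, ⟨ArchEdge.shell⟩,
    ⟨ArchEdge.multToSpaceLink⟩⟩

/-- At a NONARCHIMEDEAN place no `ι⊞`-carrying edge ends at the space-link vertex (`k̄^× ↪ k̄` is excluded from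
`Γ⃗^⋉_non`, Def 5.4 (iii)/(vii)), so the `⊞`-observable `S_log⊞` offers no cycle of the above kind there: the
nonarchimedean (Lemma 3.4) content of print's Cor 5.5 (iv) is carried by the `TS`-valued observable `S_log` only
(`Cor55LogWall`).  Stated for `b = false`. [cite: MochizukiAbsTopIII2015, Def 5.4 (iii) p. 126] -/
theorem isEmpty_logEdge_spaceLink_of_eq_false (b : Bool) (hb : b = false) (ν : LogVertex b) :
    IsEmpty (LogEdge b ν (LogVertex.spaceLink b)) := by
  subst hb
  refine ⟨fun e => ?_⟩
  obtain ⟨e, he⟩ := e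
  cases e
  exact he

/-- **[AbsTopIII] Cor 5.5 (iv), first sentence, `⊞`-half, from the ARCHIMEDEAN cycle obstruction** (the Lemma 4.4 /
Cor 4.5 (iv) mechanism at one archimedean place `v₀ ∈ V(F_mod)`): if for some object `x₀` of `𝒳`, for every
3-edge cycle `postLog → ν₂ → νₘ → spaceLink` of `Γ⃗^log_{v₀}` (at an archimedean place there is exactly the printed
one `k~ →(id) k~ ↠ k^× ↪ k`, cf. `exists_logCycle_of_eq_true`) and every isomorphism `a : x₀ ⥲ log(x₀)`, the composite
`λ⊞_{sl}(a) ≫ ι⊞_{ε₁} ≫ ι⊞_{ε₂} ≫ ι⊞_{ε₃}` at `x₀` is not the identity ("`k ⥲ k~ ↠(exp) k^× ↪ k` is not the identity"),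
then `L.Cor55Incompatibility`. [cite: MochizukiAbsTopIII2015, Cor 5.5 (iv) p. 131] -/
theorem cor55Incompatibility_of_archObstruction (v₀ : Vmod) (hv₀ : isArc v₀ = true) (x₀ : L.X)
    (obstruction : ∀ (ν₂ νₘ : LogVertex (isArc v₀)) (_ : ν₂.isPostLog = false) (_ : νₘ.isPostLog = false)
      (ε₁ : LogEdge (isArc v₀) (LogVertex.postLog (isArc v₀)) ν₂) (ε₂ : LogEdge (isArc v₀) ν₂ νₘ)
      (ε₃ : LogEdge (isArc v₀) νₘ (LogVertex.spaceLink (isArc v₀))) (a : x₀ ⟶ L.log.obj x₀), IsIso a →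
      ∀ (m₁ : (L.lam v₀ (LogVertex.spaceLink (isArc v₀))).obj (L.log.obj x₀) ⟶ (L.lam v₀ ν₂).obj x₀)
        (m₂ : (L.lam v₀ ν₂).obj x₀ ⟶ (L.lam v₀ νₘ).obj x₀)
        (m₃ : (L.lam v₀ νₘ).obj x₀ ⟶ (L.lam v₀ (LogVertex.spaceLink (isArc v₀))).obj x₀),
        HEq m₁ ((L.iota v₀ ε₁).app x₀) → HEq m₂ ((L.iota v₀ ε₂).app x₀) → HEq m₃ ((L.iota v₀ ε₃).app x₀) →
          (L.lam v₀ (LogVertex.spaceLink (isArc v₀))).map a ≫ m₁ ≫ m₂ ≫ m₃ ≠ 𝟙 _) :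
    L.Cor55Incompatibility := by
  obtain ⟨ν₂, νₘ, h₂, hₘ, ⟨ε₁⟩, ⟨ε₂⟩, ⟨ε₃⟩⟩ := exists_logCycle_of_eq_true (isArc v₀) hv₀
  exact L.cor55Incompatibility_of_cycleObstruction v₀ ν₂ νₘ h₂ hₘ ε₁ ε₂ ε₃ x₀ (obstruction ν₂ νₘ h₂ hₘ ε₁ ε₂ ε₃)

end LogFrobeniusSetting

end Literature.AnabelianGeometry.AbsoluteAnabelian
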